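import Mathlib.Topology.MetricSpace.Contracting
import Mathlib.Topology.ContinuousMap.Bounded.Normed
import Mathlib.Analysis.Normed.Group.InfiniteSum
import Mathlib.Analysis.SpecificLimits.Basic
import Mathlib.Analysis.SpecialFunctions.Pow.Real
import Mathlib.Tactic.LinearCombination
import Literature.MathematicalPhysics.QuantumLattice.FermiRG.Mastropietro2005
import HarnessLib

/-!
# Mastropietro (2005), §4.4 Lemma 2 («the choice of the counterterms») — the fixed-point argument, PROVED

V. Mastropietro, *Rigorous proof of Luttinger liquid behavior in the 1d Hubbard model*, J. Stat. Phys.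
**121** (2005) 373–432 = arXiv:cond-mat/0502415 [Mastropietro2005], held as `paper:arxiv-cond-mat_0502415`;
locators `p00NN:Lnn` = chunk:line of that TeX render (as in the sibling statement file
`FermiRG/Mastropietro2005.lean`, typer-wave file F8a of cell `gate-hubbard-kl`, row `Mas05.L2`).

Theorem-only companion of `FermiRG/Mastropietro2005.lean` §C.  There Lemma 2 (p0011:L151–154: "There exist
sequences `ν = {ν_h}_{h≤1}`, `δ = {δ_h}_{h≤1}` such that `|ν_h| ≤ cUγ^{ϑh}`, `|δ_h| ≤ cUγ^{ϑh}`", solving the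
counterterm flow `ν_{h-1} = γν_h + β_ν^{(h)}`, `δ_{h-1} = δ_h + β_δ^{(h)}`) is typed AROUND the 1D Hubbard
counterterm Beta functionals as the predicate `Mastropietro2005.Lemma2Statement βν βδ c U γ ϑ` (the model's
functionals are not an object of the tree, cell GAP-LEDGER G-t8-1).  The printed PROOF (p0012:L4–59), however,
uses exactly two properties of those functionals — a SIZE bound on the ball `𝓜_ϑ` and a weighted LIPSCHITZ
bound — and is otherwise an abstract contraction argument.  This file proves that argument for ARBITRARY
functionals with those two properties, following the print step by step:

* the space `𝓜_ϑ` of pairs of sequences with `|ν_k|, |δ_k| ≲ γ^{ϑk}` (p0012:L22–28) — realised as the closed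
  ball of radius `cU` of the Banach space `ℤ →ᵇ ℝ × ℝ` in the RESCALED coordinates `x_h = γ^{-ϑh}ν_h`,
  `y_h = γ^{-ϑh}δ_h` (so the weighted norm `‖·‖_ϑ` is the sup norm);
* the operator `T` of `\Eq(5.8c)`–`\Eq(5.8cs)` (p0012:L30–38), `(Tν)_h = -Σ_{k≤h} γ^{k-h-1}β^k_ν`,
  `(Tδ)_h = -Σ_{k≤h} β^k_δ` — written with `k = h - j`, `j ∈ ℕ`, as `-Σ_j γ^{-(j+1)} β^{h-j}_ν`,
  `-Σ_j β^{h-j}_δ` (absolutely convergent geometric-dominated series, `summable_and_abs_tsum_le_of_le_geometric`);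
* "`T` leaves `𝓜_ϑ` invariant" `\Eq(aaa12)` (p0012:L40–46): `|(Tν)_h| ≤ Σ_{k≤h} c₁Uγ^{ϑk}γ^{k-h} ≤ cUγ^{ϑh}` —
  here under the explicit relation `c₁ ≤ c(1 - γ^{-ϑ})` between the size constant and the radius;
* "`T` is a contraction on `𝓜_ϑ`" `\Eq(5.8e)` (p0012:L48–58): from the per-scale weighted Lipschitz bound
  `|β^k(ν,δ) - β^k(ν',δ')| ≤ c₂Uγ^{ϑk}[‖ν-ν'‖_ϑ + ‖δ-δ'‖_ϑ]`, ratio `2c₂U(1-γ^{-ϑ})⁻¹ ≤ 1/2` under the explicit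
  smallness `4c₂U ≤ 1 - γ^{-ϑ}` ("if `U` is sufficiently small", p0012:L40);
* "Then, a unique fixed point … exists on `𝓜_ϑ`" (p0012:L59) — Mathlib's `ContractingWith.fixedPoint` on the
  complete ball — and the fixed point satisfies the series representation `\Eq(5.8b)` (p0012:L16–20) and hence
  the recursion (b2)–(b3) (`tsum_shift_relevant`, `tsum_shift_marginal`: the one-step index shift).

Main results: `counterterm_fixedPoint_exists` (explicit constants, ball bound at every scale, `\Eq(5.8b)`,
recursion), `counterterm_solution_unique` (the printed "unique": two solutions of the flow in the ball
coincide), `lemma2Statement_of_lipschitz` (⇒ `Lemma2Statement βν βδ c U γ ϑ`), and the printed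
"`U` small enough" form `lemma2Statement_of_small_coupling`.  What is NOT proved here and stays GAP G-t8-1:
that the Beta functionals OF THE 1D HUBBARD MODEL obey the size bound (`\Eq(aa2)`, `\Eq(aaa1)`, p0011:L156 –
p0012:L3, a parity property of `g_L`) and the Lipschitz bound `\Eq(5.8e)`.  `d = 1` methodology (the same
scale-by-scale fixed-point choice of counterterms is the device of BGM 2006 §3 in `d = 2`); nothing here
concerns the 2D Hubbard model or asserts anything about superconductivity.  No definitions, no `sorry`, no new
named fact (net fact debt 0).

## Dictionary `d = 1` ↦ `d = 2` (cell `gate-hubbard-kl`, DAG aid row `R2dTHM.T3ct`, for the K3 split of route `KLProgramme`)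

This file is the `d = 1` sibling of child 2 `KLRegimeCounterterm` of the glued split of crux K3 `KLRegimeTwoPointLimit`
(`Summit.HubbardSuperconductivity.HubbardSuperconductivity.Theorems.KLRegimeSplit.KLRegimeCounterterm`, module
`Theorems/KLProgrammeKLRegimeSplitDefs.lean`): the SAME step — the counterterms are not flowed but CHOSEN, all scales
at once, as the fixed point of a contraction on an a-priori weighted ball — under the following dictionary (left:
Mastropietro 2005 §4.4 as proved here; right: the vocabulary of `Theorems/KLProgrammeKLRegimeSplit{Consts,Predicates,
Defs}.lean`, rev. of 2026-08-26):
* the POINT Fermi surface `{ω p_F}`, `ω = ±` (held fixed: `ν` tunes the chemical potential, `δ` the Fermi velocity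
  `v₀ = sin p_F`) ↦ the Fermi CURVE `{e_K = 0}` of the frame band `e_K = ε - μ - K` (`frameLevel μ K`), `K : TrigPolyC4v`
  a `C₄ᵥ`-symmetric trigonometric polynomial; what replaces `p_F` is the geometry certificate (i) of
  `FrameOK R U N μ K`, `GeomConstants (frameLevel μ K) 7 (3/80) (1/2) (3/200)` — the `FrameOK` radii: tube half-width
  `3/80`, gradient floor `1/2`, tangential-curvature floor `3/200`, derivative ceiling `7`;
* two numbers per scale `(ν_h, δ_h)`, `h ≤ 1`, in the ball `𝓜_ϑ = {|ν_h|, |δ_h| ≤ cUγ^{ϑh}}` ↦ one frame PIECE per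
  scale `Kp n : TrigPolyC4v`, `n ≤ N = nScales β`, with `‖Dʲ(Kp n)‖ ≤ R.Gfr j · uPow j U · 4^{(j-2)n}` (clause (ii) of
  `FrameOK`); so the ball `𝓜_ϑ` ↦ the frame ball `{K : TrigPolyC4v | FrameOK R U (nScales β) μ K}` in `TrigPolyC4v`;
  `γ` ↦ `4`, `h` ↦ `-n`; infinitely many scales (`β = ∞`) ↦ the `n ≤ n_β` scales of `T > 0`, bounds UNIFORM in `n_β`;
* the map `T` of `\Eq(5.8c)`–`\Eq(5.8cs)`, `(Tν)_h = -Σ_{k≤h} γ^{k-h-1}β^k_ν`, `(Tδ)_h = -Σ_{k≤h} β^k_δ` ↦ the counterterm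
  map `K ↦ -Σ_{n≤N} ℓ_n(K)`, `ℓ_n(K) = klTwoLegPiece … K n` the scale-`n` two-leg piece (`Σ_{n≤N} ℓ_n = D_N ⊖ K`);
* the SIZE bound on `𝓜_ϑ` (hypothesis `hsize`, the input of `\Eq(aaa12)` "`T` leaves `𝓜_ϑ` invariant":
  `|β^k| ≤ c₁Uγ^{ϑk}`, `c₁ ≤ c(1-γ^{-ϑ})`) ↦ (E3a) `TwoLegSizes` + (E3b) `TwoLegFloor` of `TwoLegStepAt` (self-map of the
  frame ball, via `GeomConstants.of_perturbation` and the analysis-window geometry);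
* the weighted LIPSCHITZ bound (hypothesis `hlip`, the input of `\Eq(5.8e)`: `|β^k(ν,δ) - β^k(ν',δ')| ≤
  c₂Uγ^{ϑk}(‖ν-ν'‖_ϑ + ‖δ-δ'‖_ϑ)`, contraction ratio `2c₂U(1-γ^{-ϑ})⁻¹ ≤ 1/2`) ↦ (E3c) `TwoLegLipschitz`
  (`sup |ℓ_n(K) - ℓ_n(K')| ≤ lipBar n · frameDist K K'`, `Σ_n lipBar n = O(|U|) < 1`);
* the conclusion `Lemma2Statement βν βδ c U γ ϑ` — a fixed point IN the ball solving the counterterm flow at every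
  `h ≤ 1` (`counterterm_fixedPoint_exists`, `lemma2Statement_of_lipschitz`; uniqueness `counterterm_solution_unique`)
  ↦ the conclusion of `KLRegimeCounterterm`, `∃ K, FrameOK R U (nScales β) μ K ∧ ∀ n ≤ nScales β, RenormalisedAt L M β U
  μ K R n` (the renormalisation condition «Fermi mismatch `≤ cr·|U|·Λ_n`, `|z_n - 1| ≤ cz·|U|` on the shell `S_n`» at
  every scale is the `d = 2` form of "the dressed Fermi points stay at `±p_F`, with velocity `v₀ + O(U)`").
The dictionary identifies PROOF ARCHITECTURE (Banach's fixed point on a scale-weighted ball, from a size bound and a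
Lipschitz bound on the per-scale two-leg output), not statements: nothing in this file is about `d = 2`, and the
`d = 2` inputs (E3a)–(E3c) are what the sibling children `KLRegimeEngine` / `KLRegimeBetaSplit` deliver there.
-/

noncomputable section

open Filter Metric Function
open scoped Topology NNReal BoundedContinuousFunction

namespace Literature.MathematicalPhysics.QuantumLattice.FermiRG

namespace Mastropietro2005

/-! ## §A. Series bookkeeping for `\Eq(5.8b)`–`\Eq(5.8cs)` -/

/-- The scale weights: `γ^{ϑ(h-j)} = γ^{ϑh}(γ^{-ϑ})^j` for `h ∈ ℤ`, `j ∈ ℕ` (the sums `Σ_{k≤h}` of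
`\Eq(5.8c)`–`\Eq(5.8cs)` are written with `k = h - j`). [cite: Mastropietro2005, §4.4 (5.8c)-(5.8cs) (p0012:L30-38)] -/
theorem rpow_scale_sub_nat {γ : ℝ} (hγ : 0 < γ) (θ : ℝ) (h : ℤ) (j : ℕ) :
    γ ^ (θ * ((h - (j : ℤ) : ℤ) : ℝ)) = γ ^ (θ * (h : ℝ)) * (γ ^ (-θ)) ^ j := by
  rw [← Real.rpow_natCast (γ ^ (-θ)) j, ← Real.rpow_mul hγ.le, ← Real.rpow_add hγ]
  congr 1
  push_cast
  ring

/-- Geometric domination `|a_j| ≤ C r^j`, `0 ≤ r < 1`, gives absolute convergence and `|Σ_j a_j| ≤ C/(1-r)` —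
the estimate behind `\Eq(aaa12)` and `\Eq(5.8e)`. [cite: Mastropietro2005, §4.4 (aaa12) (p0012:L40-46)] -/
theorem summable_and_abs_tsum_le_of_le_geometric {a : ℕ → ℝ} {C r : ℝ} (hr0 : 0 ≤ r) (hr1 : r < 1)
    (ha : ∀ j, |a j| ≤ C * r ^ j) : Summable a ∧ |∑' j, a j| ≤ C * (1 - r)⁻¹ := by
  have hg : HasSum (fun j : ℕ => C * r ^ j) (C * (1 - r)⁻¹) :=
    (hasSum_geometric_of_lt_one hr0 hr1).mul_left C
  have ha' : ∀ j, ‖a j‖ ≤ C * r ^ j := fun j => by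
    rw [Real.norm_eq_abs]
    exact ha j
  refine ⟨.of_norm_bounded hg.summable ha', ?_⟩
  have := tsum_of_norm_bounded hg ha'
  rwa [Real.norm_eq_abs] at this

/-- The one-step index shift of the RELEVANT counterterm series: with `(Tν)_h = -Σ_{j≥0} γ^{-(j+1)}β^{h-j}`,
`γ(Tν)_h + β^h = (Tν)_{h-1}`, i.e. `\Eq(5.8b)` solves `ν_{h-1} = γν_h + β^h_ν`.
[cite: Mastropietro2005, §4.4 (5.8b) (p0012:L16-17) with (b2) (p0010:L47-49)] -/
theorem tsum_shift_relevant (β : ℤ → (ℤ → ℝ) → (ℤ → ℝ) → ℝ) (ν δ : ℤ → ℝ) {γ : ℝ} (hγ : γ ≠ 0)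
    (h : ℤ) (hs : Summable fun j : ℕ => (γ ^ (j + 1))⁻¹ * β (h - j) ν δ) :
    γ * (∑' j : ℕ, (γ ^ (j + 1))⁻¹ * β (h - j) ν δ) =
      β h ν δ + ∑' j : ℕ, (γ ^ (j + 1))⁻¹ * β (h - 1 - j) ν δ := by
  rw [← hs.tsum_mul_left γ, (hs.mul_left γ).tsum_eq_zero_add]
  congr 1
  · rw [zero_add, pow_one, Nat.cast_zero, sub_zero, ← mul_assoc, mul_inv_cancel₀ hγ, one_mul]
  · refine tsum_congr fun j => ?_
    have hidx : (h - ((j + 1 : ℕ) : ℤ)) = h - 1 - (j : ℤ) := by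
      push_cast
      ring
    have hne : γ ^ (j + 1) ≠ 0 := pow_ne_zero _ hγ
    rw [hidx, pow_succ γ (j + 1), mul_inv, ← mul_assoc, ← mul_assoc, mul_comm γ, mul_assoc _ γ,
      mul_inv_cancel₀ hγ, mul_one]

/-- The one-step index shift of the MARGINAL counterterm series: with `(Tδ)_h = -Σ_{j≥0} β^{h-j}`,
`(Tδ)_h + β^h = (Tδ)_{h-1}`, i.e. `\Eq(5.8b)` solves `δ_{h-1} = δ_h + β^h_δ`.
[cite: Mastropietro2005, §4.4 (5.8b) (p0012:L19-20) with (b3) (p0010:L47-49)] -/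
theorem tsum_shift_marginal (β : ℤ → (ℤ → ℝ) → (ℤ → ℝ) → ℝ) (ν δ : ℤ → ℝ) (h : ℤ)
    (hs : Summable fun j : ℕ => β (h - j) ν δ) :
    (∑' j : ℕ, β (h - j) ν δ) = β h ν δ + ∑' j : ℕ, β (h - 1 - j) ν δ := by
  rw [hs.tsum_eq_zero_add]
  congr 1
  · simp
  · refine tsum_congr fun j => ?_
    have hidx : (h - ((j + 1 : ℕ) : ℤ)) = h - 1 - (j : ℤ) := by
      push_cast
      ring
    rw [hidx]

/-! ## §B. Lemma 2 — the contraction argument of p0012:L22–59 for abstract counterterm Beta functionals -/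

/-- `Mas05.L2` · **Mastropietro 2005, Lemma 2 — the fixed-point construction, PROVED for arbitrary counterterm
Beta functionals with the two printed properties.**  Data as in `Lemma2Statement`: functionals `βν h`, `βδ h`
of the whole pair of sequences `(ν, δ) : (ℤ → ℝ) × (ℤ → ℝ)` (the quartic couplings being solved for
parametrically, Lemma 1), scaling parameter `γ > 1`, exponent `ϑ > 0`, coupling `U ≥ 0`, radius constant `c`,
size constant `c₁`, Lipschitz constant `c₂`.  Hypotheses: (size, the input of `\Eq(aaa12)`) on the ball
`𝓜 = {|ν_h|, |δ_h| ≤ cUγ^{ϑh} ∀h}` every `β^k`, `k ≤ 1`, is bounded by `c₁Uγ^{ϑk}`; (Lipschitz, the input of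
`\Eq(5.8e)`) on `𝓜`, `|β^k(ν,δ) - β^k(ν',δ')| ≤ c₂Uγ^{ϑk}(D₁ + D₂)` whenever `|ν_h - ν'_h| ≤ D₁γ^{ϑh}` and
`|δ_h - δ'_h| ≤ D₂γ^{ϑh}` for all `h` (i.e. `D₁ ≥ ‖ν-ν'‖_ϑ`, `D₂ ≥ ‖δ-δ'‖_ϑ`); and the explicit constants
relations `c₁ ≤ c(1-γ^{-ϑ})` (invariance of `𝓜`) and `4c₂U ≤ 1-γ^{-ϑ}` (contraction ratio `≤ 1/2`; "if `U` is
sufficiently small").  Conclusion: there are sequences `ν, δ` in `𝓜` (bound at EVERY `h ∈ ℤ`; they vanish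
above scale `1`) such that for every `h ≤ 1` the series `\Eq(5.8b)` converge absolutely,
`ν_h = -Σ_{j≥0} γ^{-(j+1)} β_ν^{h-j}(ν,δ)`, `δ_h = -Σ_{j≥0} β_δ^{h-j}(ν,δ)` (= `-Σ_{k≤h}γ^{k-h-1}β^k_ν`,
`-Σ_{k≤h}β^k_δ`), and the counterterm flow equations `ν_{h-1} = γν_h + β_ν^{(h)}`, `δ_{h-1} = δ_h + β_δ^{(h)}`
hold.  Proof = the printed one: `T` of `\Eq(5.8c)`–`\Eq(5.8cs)` is a `1/2`-contraction of the complete ball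
`𝓜` (in rescaled coordinates, a closed ball of `ℤ →ᵇ ℝ × ℝ`), Banach's fixed point theorem, then the index
shift.  [cite: Mastropietro2005, §4.4 Lemma 2 (p0011:L151-154), proof (5.8a)-(5.8e) (p0012:L4-59)] -/
theorem counterterm_fixedPoint_exists (βν βδ : ℤ → (ℤ → ℝ) → (ℤ → ℝ) → ℝ) {c c₁ c₂ U γ θ : ℝ}
    (hγ : 1 < γ) (hθ : 0 < θ) (hU : 0 ≤ U) (hc₁ : 0 ≤ c₁)
    (hc : c₁ ≤ c * (1 - γ ^ (-θ))) (hsmall : 4 * c₂ * U ≤ 1 - γ ^ (-θ))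
    (hsize : ∀ ν δ : ℤ → ℝ,
      (∀ h : ℤ, |ν h| ≤ c * U * γ ^ (θ * (h : ℝ)) ∧ |δ h| ≤ c * U * γ ^ (θ * (h : ℝ))) →
        ∀ k : ℤ, k ≤ 1 →
          |βν k ν δ| ≤ c₁ * U * γ ^ (θ * (k : ℝ)) ∧ |βδ k ν δ| ≤ c₁ * U * γ ^ (θ * (k : ℝ)))
    (hlip : ∀ ν δ ν' δ' : ℤ → ℝ, ∀ D₁ D₂ : ℝ,
      (∀ h : ℤ, |ν h| ≤ c * U * γ ^ (θ * (h : ℝ)) ∧ |δ h| ≤ c * U * γ ^ (θ * (h : ℝ))) →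
      (∀ h : ℤ, |ν' h| ≤ c * U * γ ^ (θ * (h : ℝ)) ∧ |δ' h| ≤ c * U * γ ^ (θ * (h : ℝ))) →
      0 ≤ D₁ → 0 ≤ D₂ →
      (∀ h : ℤ, |ν h - ν' h| ≤ D₁ * γ ^ (θ * (h : ℝ))) →
      (∀ h : ℤ, |δ h - δ' h| ≤ D₂ * γ ^ (θ * (h : ℝ))) →
        ∀ k : ℤ, k ≤ 1 →
          |βν k ν δ - βν k ν' δ'| ≤ c₂ * U * γ ^ (θ * (k : ℝ)) * (D₁ + D₂) ∧
          |βδ k ν δ - βδ k ν' δ'| ≤ c₂ * U * γ ^ (θ * (k : ℝ)) * (D₁ + D₂)) :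
    ∃ ν δ : ℤ → ℝ,
      (∀ h : ℤ, |ν h| ≤ c * U * γ ^ (θ * (h : ℝ)) ∧ |δ h| ≤ c * U * γ ^ (θ * (h : ℝ))) ∧
      (∀ h : ℤ, h ≤ 1 →
        (Summable fun j : ℕ => (γ ^ (j + 1))⁻¹ * βν (h - j) ν δ) ∧
        (Summable fun j : ℕ => βδ (h - j) ν δ) ∧
        ν h = -∑' j : ℕ, (γ ^ (j + 1))⁻¹ * βν (h - j) ν δ ∧
        δ h = -∑' j : ℕ, βδ (h - j) ν δ) ∧
      (∀ h : ℤ, h ≤ 1 → ν (h - 1) = γ * ν h + βν h ν δ ∧ δ (h - 1) = δ h + βδ h ν δ) := by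
  -- constants
  have hγ0 : 0 < γ := lt_trans zero_lt_one hγ
  have hγne : γ ≠ 0 := hγ0.ne'
  set r : ℝ := γ ^ (-θ)
  have hr0 : 0 < r := Real.rpow_pos_of_pos hγ0 _
  have hr1 : r < 1 := Real.rpow_lt_one_of_one_lt_of_neg hγ (by linarith)
  have h1r : 0 < 1 - r := by linarith
  have hc0 : 0 ≤ c := by
    by_contra hneg
    push Not at hneg
    have : c * (1 - r) < 0 := mul_neg_of_neg_of_pos hneg h1r
    linarith
  set R : ℝ := c * U with hR_def
  have hR0 : 0 ≤ R := mul_nonneg hc0 hU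
  have hw : ∀ h : ℤ, 0 < γ ^ (θ * (h : ℝ)) := fun h => Real.rpow_pos_of_pos hγ0 _
  have hws : ∀ (h : ℤ) (j : ℕ), γ ^ (θ * ((h - (j : ℤ) : ℤ) : ℝ)) = γ ^ (θ * (h : ℝ)) * r ^ j :=
    fun h j => rpow_scale_sub_nat hγ0 θ h j
  have hginv : ∀ j : ℕ, 0 < (γ ^ (j + 1))⁻¹ ∧ (γ ^ (j + 1))⁻¹ ≤ 1 := fun j =>
    ⟨inv_pos.2 (pow_pos hγ0 _), inv_le_one_of_one_le₀ (one_le_pow₀ hγ.le)⟩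
  have hK1 : c₁ * U * (1 - r)⁻¹ ≤ R := by
    have h1 : c₁ * (1 - r)⁻¹ ≤ c := by
      rw [mul_inv_le_iff₀ h1r]
      exact hc
    calc c₁ * U * (1 - r)⁻¹ = c₁ * (1 - r)⁻¹ * U := by ring
      _ ≤ c * U := mul_le_mul_of_nonneg_right h1 hU
  have hK2 : 2 * c₂ * U * (1 - r)⁻¹ ≤ 1 / 2 := by
    rw [mul_inv_le_iff₀ h1r]
    linarith
  -- `𝓜_ϑ` in rescaled coordinates: the closed ball of radius `R = cU` of `ℤ →ᵇ ℝ × ℝ`; unscaling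
  let nuOf : (ℤ →ᵇ ℝ × ℝ) → ℤ → ℝ := fun f h => γ ^ (θ * (h : ℝ)) * (f h).1
  let deOf : (ℤ →ᵇ ℝ × ℝ) → ℤ → ℝ := fun f h => γ ^ (θ * (h : ℝ)) * (f h).2
  have hcoord : ∀ f ∈ closedBall (0 : ℤ →ᵇ ℝ × ℝ) R, ∀ h : ℤ, |(f h).1| ≤ R ∧ |(f h).2| ≤ R := by
    intro f hf h
    have h1 : ‖f‖ ≤ R := by rwa [mem_closedBall, dist_zero_right] at hf
    have h2 : ‖f h‖ ≤ R := (f.norm_coe_le_norm h).trans h1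
    rw [Prod.norm_def, max_le_iff, Real.norm_eq_abs, Real.norm_eq_abs] at h2
    exact h2
  have hball : ∀ f ∈ closedBall (0 : ℤ →ᵇ ℝ × ℝ) R, ∀ h : ℤ,
      |nuOf f h| ≤ c * U * γ ^ (θ * (h : ℝ)) ∧ |deOf f h| ≤ c * U * γ ^ (θ * (h : ℝ)) := by
    intro f hf h
    obtain ⟨h1, h2⟩ := hcoord f hf h
    have hwh := hw h
    constructor
    · show |γ ^ (θ * (h : ℝ)) * (f h).1| ≤ _
      rw [abs_mul, abs_of_pos hwh]
      calc γ ^ (θ * (h : ℝ)) * |(f h).1| ≤ γ ^ (θ * (h : ℝ)) * R :=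
            mul_le_mul_of_nonneg_left h1 hwh.le
        _ = c * U * γ ^ (θ * (h : ℝ)) := by rw [hR_def]; ring
    · show |γ ^ (θ * (h : ℝ)) * (f h).2| ≤ _
      rw [abs_mul, abs_of_pos hwh]
      calc γ ^ (θ * (h : ℝ)) * |(f h).2| ≤ γ ^ (θ * (h : ℝ)) * R :=
            mul_le_mul_of_nonneg_left h2 hwh.le
        _ = c * U * γ ^ (θ * (h : ℝ)) := by rw [hR_def]; ring
  have hclose : ∀ (f g : ℤ →ᵇ ℝ × ℝ) (h : ℤ),
      |nuOf f h - nuOf g h| ≤ dist f g * γ ^ (θ * (h : ℝ)) ∧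
      |deOf f h - deOf g h| ≤ dist f g * γ ^ (θ * (h : ℝ)) := by
    intro f g h
    have hwh := hw h
    have hd : dist (f h) (g h) ≤ dist f g := f.dist_coe_le_dist h
    rw [Prod.dist_eq, max_le_iff, Real.dist_eq, Real.dist_eq] at hd
    constructor
    · show |γ ^ (θ * (h : ℝ)) * (f h).1 - γ ^ (θ * (h : ℝ)) * (g h).1| ≤ _
      rw [← mul_sub, abs_mul, abs_of_pos hwh, mul_comm]
      exact mul_le_mul_of_nonneg_right hd.1 hwh.le
    · show |γ ^ (θ * (h : ℝ)) * (f h).2 - γ ^ (θ * (h : ℝ)) * (g h).2| ≤ _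
      rw [← mul_sub, abs_mul, abs_of_pos hwh, mul_comm]
      exact mul_le_mul_of_nonneg_right hd.2 hwh.le
  -- the series of `\Eq(5.8c)`–`\Eq(5.8cs)` (without the overall sign), `k = h - j`
  let Sν : (ℤ →ᵇ ℝ × ℝ) → ℤ → ℝ := fun f h =>
    ∑' j : ℕ, (γ ^ (j + 1))⁻¹ * βν (h - j) (nuOf f) (deOf f)
  let Sδ : (ℤ →ᵇ ℝ × ℝ) → ℤ → ℝ := fun f h => ∑' j : ℕ, βδ (h - j) (nuOf f) (deOf f)
  have hterm : ∀ f ∈ closedBall (0 : ℤ →ᵇ ℝ × ℝ) R, ∀ h : ℤ, h ≤ 1 → ∀ j : ℕ,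
      |(γ ^ (j + 1))⁻¹ * βν (h - j) (nuOf f) (deOf f)| ≤ c₁ * U * γ ^ (θ * (h : ℝ)) * r ^ j ∧
      |βδ (h - j) (nuOf f) (deOf f)| ≤ c₁ * U * γ ^ (θ * (h : ℝ)) * r ^ j := by
    intro f hf h hh j
    have hk : h - (j : ℤ) ≤ 1 := by omega
    obtain ⟨b1, b2⟩ := hsize (nuOf f) (deOf f) (hball f hf) (h - j) hk
    rw [hws h j, ← mul_assoc] at b1 b2
    refine ⟨?_, b2⟩
    rw [abs_mul, abs_of_pos (hginv j).1]
    exact (mul_le_of_le_one_left (abs_nonneg _) (hginv j).2).trans b1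
  have hSum : ∀ f ∈ closedBall (0 : ℤ →ᵇ ℝ × ℝ) R, ∀ h : ℤ, h ≤ 1 →
      (Summable fun j : ℕ => (γ ^ (j + 1))⁻¹ * βν (h - j) (nuOf f) (deOf f)) ∧
      |Sν f h| ≤ c₁ * U * γ ^ (θ * (h : ℝ)) * (1 - r)⁻¹ ∧
      (Summable fun j : ℕ => βδ (h - j) (nuOf f) (deOf f)) ∧
      |Sδ f h| ≤ c₁ * U * γ ^ (θ * (h : ℝ)) * (1 - r)⁻¹ := by
    intro f hf h hh
    have A := summable_and_abs_tsum_le_of_le_geometric hr0.le hr1 fun j => (hterm f hf h hh j).1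
    have A' := summable_and_abs_tsum_le_of_le_geometric hr0.le hr1 fun j => (hterm f hf h hh j).2
    exact ⟨A.1, A.2, A'.1, A'.2⟩
  -- `\Eq(5.8e)`: the per-scale Lipschitz bound summed over `k ≤ h`
  have hLipS : ∀ f ∈ closedBall (0 : ℤ →ᵇ ℝ × ℝ) R, ∀ g ∈ closedBall (0 : ℤ →ᵇ ℝ × ℝ) R,
      ∀ h : ℤ, h ≤ 1 →
      |Sν f h - Sν g h| ≤ 2 * c₂ * U * dist f g * γ ^ (θ * (h : ℝ)) * (1 - r)⁻¹ ∧
      |Sδ f h - Sδ g h| ≤ 2 * c₂ * U * dist f g * γ ^ (θ * (h : ℝ)) * (1 - r)⁻¹ := by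
    intro f hf g hg h hh
    have hD : 0 ≤ dist f g := dist_nonneg
    have hlk : ∀ j : ℕ,
        |βν (h - j) (nuOf f) (deOf f) - βν (h - j) (nuOf g) (deOf g)| ≤
          c₂ * U * γ ^ (θ * (h : ℝ)) * r ^ j * (dist f g + dist f g) ∧
        |βδ (h - j) (nuOf f) (deOf f) - βδ (h - j) (nuOf g) (deOf g)| ≤
          c₂ * U * γ ^ (θ * (h : ℝ)) * r ^ j * (dist f g + dist f g) := by
      intro j
      have hk : h - (j : ℤ) ≤ 1 := by omega
      have key := hlip (nuOf f) (deOf f) (nuOf g) (deOf g) (dist f g) (dist f g) (hball f hf)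
        (hball g hg) hD hD (fun h' => (hclose f g h').1) (fun h' => (hclose f g h').2) (h - j) hk
      rw [hws h j, ← mul_assoc] at key
      exact key
    obtain ⟨sf1, -, sf2, -⟩ := hSum f hf h hh
    obtain ⟨sg1, -, sg2, -⟩ := hSum g hg h hh
    constructor
    · have e : Sν f h - Sν g h = ∑' j : ℕ, (γ ^ (j + 1))⁻¹ *
          (βν (h - j) (nuOf f) (deOf f) - βν (h - j) (nuOf g) (deOf g)) := by
        simp only [Sν]
        rw [← sf1.tsum_sub sg1]
        exact tsum_congr fun j => by ring
      have hmaj : ∀ j : ℕ, |(γ ^ (j + 1))⁻¹ *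
          (βν (h - j) (nuOf f) (deOf f) - βν (h - j) (nuOf g) (deOf g))| ≤
          c₂ * U * γ ^ (θ * (h : ℝ)) * (dist f g + dist f g) * r ^ j := by
        intro j
        rw [abs_mul, abs_of_pos (hginv j).1]
        calc (γ ^ (j + 1))⁻¹ * |βν (h - j) (nuOf f) (deOf f) - βν (h - j) (nuOf g) (deOf g)|
            ≤ |βν (h - j) (nuOf f) (deOf f) - βν (h - j) (nuOf g) (deOf g)| :=
              mul_le_of_le_one_left (abs_nonneg _) (hginv j).2
          _ ≤ c₂ * U * γ ^ (θ * (h : ℝ)) * r ^ j * (dist f g + dist f g) := (hlk j).1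
          _ = c₂ * U * γ ^ (θ * (h : ℝ)) * (dist f g + dist f g) * r ^ j := by ring
      have hb := (summable_and_abs_tsum_le_of_le_geometric hr0.le hr1 hmaj).2
      rw [e]
      calc _ ≤ c₂ * U * γ ^ (θ * (h : ℝ)) * (dist f g + dist f g) * (1 - r)⁻¹ := hb
        _ = 2 * c₂ * U * dist f g * γ ^ (θ * (h : ℝ)) * (1 - r)⁻¹ := by ring
    · have e : Sδ f h - Sδ g h = ∑' j : ℕ,
          (βδ (h - j) (nuOf f) (deOf f) - βδ (h - j) (nuOf g) (deOf g)) := by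
        simp only [Sδ]
        rw [← sf2.tsum_sub sg2]
      have hmaj : ∀ j : ℕ, |βδ (h - j) (nuOf f) (deOf f) - βδ (h - j) (nuOf g) (deOf g)| ≤
          c₂ * U * γ ^ (θ * (h : ℝ)) * (dist f g + dist f g) * r ^ j := by
        intro j
        calc _ ≤ c₂ * U * γ ^ (θ * (h : ℝ)) * r ^ j * (dist f g + dist f g) := (hlk j).2
          _ = c₂ * U * γ ^ (θ * (h : ℝ)) * (dist f g + dist f g) * r ^ j := by ring
      have hb := (summable_and_abs_tsum_le_of_le_geometric hr0.le hr1 hmaj).2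
      rw [e]
      calc _ ≤ c₂ * U * γ ^ (θ * (h : ℝ)) * (dist f g + dist f g) * (1 - r)⁻¹ := hb
        _ = 2 * c₂ * U * dist f g * γ ^ (θ * (h : ℝ)) * (1 - r)⁻¹ := by ring
  -- the operator `T` of `\Eq(5.8c)`–`\Eq(5.8cs)` in rescaled coordinates (zero above scale `1`)
  let v : (ℤ →ᵇ ℝ × ℝ) → ℤ → ℝ × ℝ := fun f h =>
    if h ≤ 1 then (-((γ ^ (θ * (h : ℝ)))⁻¹ * Sν f h), -((γ ^ (θ * (h : ℝ)))⁻¹ * Sδ f h)) else 0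
  -- `\Eq(aaa12)`: `T` maps the ball into itself
  have hvn : ∀ f ∈ closedBall (0 : ℤ →ᵇ ℝ × ℝ) R, ∀ h : ℤ, ‖v f h‖ ≤ R := by
    intro f hf h
    by_cases hh : h ≤ 1
    · obtain ⟨-, b1, -, b2⟩ := hSum f hf h hh
      have hwh := hw h
      have hwi : 0 < (γ ^ (θ * (h : ℝ)))⁻¹ := inv_pos.2 hwh
      simp only [v, if_pos hh, Prod.norm_def, Real.norm_eq_abs, abs_neg]
      refine max_le ?_ ?_
      · rw [abs_mul, abs_of_pos hwi]
        calc (γ ^ (θ * (h : ℝ)))⁻¹ * |Sν f h|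
            ≤ (γ ^ (θ * (h : ℝ)))⁻¹ * (c₁ * U * γ ^ (θ * (h : ℝ)) * (1 - r)⁻¹) :=
              mul_le_mul_of_nonneg_left b1 hwi.le
          _ = c₁ * U * (1 - r)⁻¹ * ((γ ^ (θ * (h : ℝ)))⁻¹ * γ ^ (θ * (h : ℝ))) := by ring
          _ = c₁ * U * (1 - r)⁻¹ := by rw [inv_mul_cancel₀ hwh.ne', mul_one]
          _ ≤ R := hK1
      · rw [abs_mul, abs_of_pos hwi]
        calc (γ ^ (θ * (h : ℝ)))⁻¹ * |Sδ f h|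
            ≤ (γ ^ (θ * (h : ℝ)))⁻¹ * (c₁ * U * γ ^ (θ * (h : ℝ)) * (1 - r)⁻¹) :=
              mul_le_mul_of_nonneg_left b2 hwi.le
          _ = c₁ * U * (1 - r)⁻¹ * ((γ ^ (θ * (h : ℝ)))⁻¹ * γ ^ (θ * (h : ℝ))) := by ring
          _ = c₁ * U * (1 - r)⁻¹ := by rw [inv_mul_cancel₀ hwh.ne', mul_one]
          _ ≤ R := hK1
    · simp only [v, if_neg hh, norm_zero]
      exact hR0
  have hvd : ∀ f ∈ closedBall (0 : ℤ →ᵇ ℝ × ℝ) R, ∀ h h' : ℤ, dist (v f h) (v f h') ≤ 2 * R :=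
    fun f hf h h' => (dist_le_norm_add_norm _ _).trans (by linarith [hvn f hf h, hvn f hf h'])
  -- `\Eq(5.8e)`: `T` is a `1/2`-contraction of the ball
  have hvl : ∀ f ∈ closedBall (0 : ℤ →ᵇ ℝ × ℝ) R, ∀ g ∈ closedBall (0 : ℤ →ᵇ ℝ × ℝ) R, ∀ h : ℤ,
      dist (v f h) (v g h) ≤ 1 / 2 * dist f g := by
    intro f hf g hg h
    have hD : 0 ≤ dist f g := dist_nonneg
    by_cases hh : h ≤ 1
    · obtain ⟨l1, l2⟩ := hLipS f hf g hg h hh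
      have hwh := hw h
      have hwi : 0 < (γ ^ (θ * (h : ℝ)))⁻¹ := inv_pos.2 hwh
      simp only [v, if_pos hh, Prod.dist_eq, Real.dist_eq]
      refine max_le ?_ ?_
      · rw [show -((γ ^ (θ * (h : ℝ)))⁻¹ * Sν f h) - -((γ ^ (θ * (h : ℝ)))⁻¹ * Sν g h) =
            -((γ ^ (θ * (h : ℝ)))⁻¹ * (Sν f h - Sν g h)) by ring, abs_neg, abs_mul, abs_of_pos hwi]
        calc (γ ^ (θ * (h : ℝ)))⁻¹ * |Sν f h - Sν g h|
            ≤ (γ ^ (θ * (h : ℝ)))⁻¹ * (2 * c₂ * U * dist f g * γ ^ (θ * (h : ℝ)) * (1 - r)⁻¹) :=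
              mul_le_mul_of_nonneg_left l1 hwi.le
          _ = 2 * c₂ * U * (1 - r)⁻¹ * dist f g * ((γ ^ (θ * (h : ℝ)))⁻¹ * γ ^ (θ * (h : ℝ))) := by
              ring
          _ = 2 * c₂ * U * (1 - r)⁻¹ * dist f g := by rw [inv_mul_cancel₀ hwh.ne', mul_one]
          _ ≤ 1 / 2 * dist f g := mul_le_mul_of_nonneg_right hK2 hD
      · rw [show -((γ ^ (θ * (h : ℝ)))⁻¹ * Sδ f h) - -((γ ^ (θ * (h : ℝ)))⁻¹ * Sδ g h) =
            -((γ ^ (θ * (h : ℝ)))⁻¹ * (Sδ f h - Sδ g h)) by ring, abs_neg, abs_mul, abs_of_pos hwi]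
        calc (γ ^ (θ * (h : ℝ)))⁻¹ * |Sδ f h - Sδ g h|
            ≤ (γ ^ (θ * (h : ℝ)))⁻¹ * (2 * c₂ * U * dist f g * γ ^ (θ * (h : ℝ)) * (1 - r)⁻¹) :=
              mul_le_mul_of_nonneg_left l2 hwi.le
          _ = 2 * c₂ * U * (1 - r)⁻¹ * dist f g * ((γ ^ (θ * (h : ℝ)))⁻¹ * γ ^ (θ * (h : ℝ))) := by
              ring
          _ = 2 * c₂ * U * (1 - r)⁻¹ * dist f g := by rw [inv_mul_cancel₀ hwh.ne', mul_one]
          _ ≤ 1 / 2 * dist f g := mul_le_mul_of_nonneg_right hK2 hD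
    · simp only [v, if_neg hh, dist_self]
      positivity
  -- `T` as a self-map `F` of the complete ball
  have hvB : ∀ (f : ℤ →ᵇ ℝ × ℝ) (hf : f ∈ closedBall (0 : ℤ →ᵇ ℝ × ℝ) R),
      BoundedContinuousFunction.mkOfDiscrete (v f) (2 * R) (hvd f hf) ∈
        closedBall (0 : ℤ →ᵇ ℝ × ℝ) R := by
    intro f hf
    rw [mem_closedBall, dist_zero_right, BoundedContinuousFunction.norm_le hR0]
    exact fun h => hvn f hf h
  haveI : CompleteSpace (closedBall (0 : ℤ →ᵇ ℝ × ℝ) R) := isClosed_closedBall.completeSpace_coe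
  haveI : Nonempty (closedBall (0 : ℤ →ᵇ ℝ × ℝ) R) := ⟨⟨0, mem_closedBall_self hR0⟩⟩
  let F : closedBall (0 : ℤ →ᵇ ℝ × ℝ) R → closedBall (0 : ℤ →ᵇ ℝ × ℝ) R := fun p =>
    ⟨BoundedContinuousFunction.mkOfDiscrete (v p.1) (2 * R) (hvd p.1 p.2), hvB p.1 p.2⟩
  have hFapply : ∀ (p : closedBall (0 : ℤ →ᵇ ℝ × ℝ) R) (h : ℤ),
      ((F p : closedBall (0 : ℤ →ᵇ ℝ × ℝ) R) : ℤ →ᵇ ℝ × ℝ) h = v p.1 h := fun p h => rfl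
  let K : ℝ≥0 := ⟨1 / 2, by norm_num⟩
  have hF : ContractingWith K F := by
    refine ⟨?_, LipschitzWith.of_dist_le_mul fun p q => ?_⟩
    · rw [← NNReal.coe_lt_coe, NNReal.coe_one]
      show (1 / 2 : ℝ) < 1
      norm_num
    · rw [Subtype.dist_eq, Subtype.dist_eq]
      refine (BoundedContinuousFunction.dist_le ?_).2 fun h => ?_
      · positivity
      · show dist (v p.1 h) (v q.1 h) ≤ 1 / 2 * dist p.1 q.1
        exact hvl p.1 p.2 q.1 q.2 h
  -- "a unique fixed point for `T` exists on `𝓜_ϑ`" (p0012:L59)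
  obtain ⟨y, hy⟩ : ∃ y : closedBall (0 : ℤ →ᵇ ℝ × ℝ) R, F y = y :=
    ⟨ContractingWith.fixedPoint F hF, hF.fixedPoint_isFixedPt⟩
  have hyv : ∀ h : ℤ, (y : ℤ →ᵇ ℝ × ℝ) h = v y.1 h := by
    intro h
    have e := DFunLike.congr_fun (congrArg Subtype.val hy) h
    exact e.symm.trans (hFapply y h)
  have hyfix : ∀ h : ℤ, h ≤ 1 → nuOf y.1 h = -Sν y.1 h ∧ deOf y.1 h = -Sδ y.1 h := by
    intro h hh
    have e := hyv h
    simp only [v, if_pos hh] at e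
    have hwh := hw h
    constructor
    · show γ ^ (θ * (h : ℝ)) * ((y : ℤ →ᵇ ℝ × ℝ) h).1 = -Sν y.1 h
      rw [e]
      dsimp only
      rw [mul_neg, ← mul_assoc, mul_inv_cancel₀ hwh.ne', one_mul]
    · show γ ^ (θ * (h : ℝ)) * ((y : ℤ →ᵇ ℝ × ℝ) h).2 = -Sδ y.1 h
      rw [e]
      dsimp only
      rw [mul_neg, ← mul_assoc, mul_inv_cancel₀ hwh.ne', one_mul]
  -- `\Eq(5.8b)` and the recursion (b2)–(b3)
  refine ⟨nuOf y.1, deOf y.1, hball y.1 y.2, fun h hh => ?_, fun h hh => ?_⟩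
  · obtain ⟨s1, -, s2, -⟩ := hSum y.1 y.2 h hh
    obtain ⟨e1, e2⟩ := hyfix h hh
    exact ⟨s1, s2, e1, e2⟩
  · have hh' : h - 1 ≤ 1 := by omega
    obtain ⟨s1, -, s2, -⟩ := hSum y.1 y.2 h hh
    obtain ⟨e1, e2⟩ := hyfix h hh
    obtain ⟨e1', e2'⟩ := hyfix (h - 1) hh'
    constructor
    · rw [e1', e1]
      have key := tsum_shift_relevant βν (nuOf y.1) (deOf y.1) hγne h s1
      simp only [Sν]
      linear_combination key
    · rw [e2', e2]
      have key := tsum_shift_marginal βδ (nuOf y.1) (deOf y.1) h s2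
      simp only [Sδ]
      linear_combination key

/-- `Mas05.L2` (proof) · **"a unique fixed point" (p0012:L59) — uniqueness of the counterterm sequences in
the ball `𝓜_ϑ`.**  Under the weighted Lipschitz bound `\Eq(5.8e)` and the smallness `4c₂U ≤ 1-γ^{-ϑ}` alone,
two pairs of sequences in the ball `{|ν_h|, |δ_h| ≤ cUγ^{ϑh}}` that both solve the counterterm flow
`ν_{h-1} = γν_h + β_ν^{(h)}(ν,δ)`, `δ_{h-1} = δ_h + β_δ^{(h)}(ν,δ)` for all `h ≤ 1` — and carry the same
(irrelevant) values above scale `1`, where the printed sequences `{ν_h}_{h≤1}` are not defined — coincide.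
Proof: one flow step contracts the weighted distance by `γ^{-ϑ} + 2c₂U < 1` (the relevant direction even by
an extra `γ⁻¹`), iterate.  In particular the sequences of `counterterm_fixedPoint_exists` are the unique
solution in `𝓜_ϑ` vanishing above scale `1`. [cite: Mastropietro2005, §4.4 Lemma 2, proof (5.8e) (p0012:L48-59)] -/
theorem counterterm_solution_unique (βν βδ : ℤ → (ℤ → ℝ) → (ℤ → ℝ) → ℝ) {c c₂ U γ θ : ℝ}
    (hγ : 1 < γ) (hθ : 0 < θ) (hsmall : 4 * c₂ * U ≤ 1 - γ ^ (-θ))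
    (hlip : ∀ ν δ ν' δ' : ℤ → ℝ, ∀ D₁ D₂ : ℝ,
      (∀ h : ℤ, |ν h| ≤ c * U * γ ^ (θ * (h : ℝ)) ∧ |δ h| ≤ c * U * γ ^ (θ * (h : ℝ))) →
      (∀ h : ℤ, |ν' h| ≤ c * U * γ ^ (θ * (h : ℝ)) ∧ |δ' h| ≤ c * U * γ ^ (θ * (h : ℝ))) →
      0 ≤ D₁ → 0 ≤ D₂ →
      (∀ h : ℤ, |ν h - ν' h| ≤ D₁ * γ ^ (θ * (h : ℝ))) →
      (∀ h : ℤ, |δ h - δ' h| ≤ D₂ * γ ^ (θ * (h : ℝ))) →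
        ∀ k : ℤ, k ≤ 1 →
          |βν k ν δ - βν k ν' δ'| ≤ c₂ * U * γ ^ (θ * (k : ℝ)) * (D₁ + D₂) ∧
          |βδ k ν δ - βδ k ν' δ'| ≤ c₂ * U * γ ^ (θ * (k : ℝ)) * (D₁ + D₂))
    {ν δ ν' δ' : ℤ → ℝ}
    (hb : ∀ h : ℤ, |ν h| ≤ c * U * γ ^ (θ * (h : ℝ)) ∧ |δ h| ≤ c * U * γ ^ (θ * (h : ℝ)))
    (hb' : ∀ h : ℤ, |ν' h| ≤ c * U * γ ^ (θ * (h : ℝ)) ∧ |δ' h| ≤ c * U * γ ^ (θ * (h : ℝ)))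
    (hagree : ∀ h : ℤ, 1 < h → ν h = ν' h ∧ δ h = δ' h)
    (hrec : ∀ h : ℤ, h ≤ 1 → ν (h - 1) = γ * ν h + βν h ν δ ∧ δ (h - 1) = δ h + βδ h ν δ)
    (hrec' : ∀ h : ℤ, h ≤ 1 →
      ν' (h - 1) = γ * ν' h + βν h ν' δ' ∧ δ' (h - 1) = δ' h + βδ h ν' δ') :
    ∀ h : ℤ, ν h = ν' h ∧ δ h = δ' h := by
  have hγ0 : 0 < γ := lt_trans zero_lt_one hγ
  have hr0 : 0 < γ ^ (-θ) := Real.rpow_pos_of_pos hγ0 _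
  have hr1 : γ ^ (-θ) < 1 := Real.rpow_lt_one_of_one_lt_of_neg hγ (by linarith)
  have hw : ∀ h : ℤ, 0 < γ ^ (θ * (h : ℝ)) := fun h => Real.rpow_pos_of_pos hγ0 _
  have hws1 : ∀ h : ℤ, γ ^ (θ * ((h - 1 : ℤ) : ℝ)) = γ ^ (θ * (h : ℝ)) * γ ^ (-θ) := by
    intro h
    rw [← Real.rpow_add hγ0]
    congr 1
    push_cast
    ring
  -- the radius and the Lipschitz constant are nonnegative (from the hypotheses themselves)
  have hcU : 0 ≤ c * U := by
    have h0 := (hb 0).1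
    rw [Int.cast_zero, mul_zero, Real.rpow_zero, mul_one] at h0
    exact (abs_nonneg _).trans h0
  have hc₂U : 0 ≤ c₂ * U := by
    have h1 := (hlip ν δ ν δ 1 1 hb hb zero_le_one zero_le_one
      (fun h => by rw [sub_self, abs_zero, one_mul]; exact (hw h).le)
      (fun h => by rw [sub_self, abs_zero, one_mul]; exact (hw h).le) 1 le_rfl).1
    rw [sub_self, abs_zero] at h1
    by_contra hneg
    push Not at hneg
    have : c₂ * U * γ ^ (θ * ((1 : ℤ) : ℝ)) * (1 + 1) < 0 :=
      mul_neg_of_neg_of_pos (mul_neg_of_neg_of_pos hneg (hw 1)) (by norm_num)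
    linarith
  -- the contraction ratio of ONE flow step in the weighted distance
  set q : ℝ := γ ^ (-θ) + 2 * c₂ * U
  have hq0 : 0 ≤ q := by
    show (0 : ℝ) ≤ γ ^ (-θ) + 2 * c₂ * U
    linarith [hr0, hc₂U, show 2 * c₂ * U = 2 * (c₂ * U) by ring]
  have hq1 : q < 1 := by
    show γ ^ (-θ) + 2 * c₂ * U < 1
    linarith
  set D₀ : ℝ := 2 * (c * U)
  have hD0 : 0 ≤ D₀ := mul_nonneg (by norm_num) hcU
  -- iterate: the weighted distance is at most `q^m D₀` for every `m`
  have claim : ∀ m : ℕ, ∀ h : ℤ,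
      |ν h - ν' h| ≤ q ^ m * D₀ * γ ^ (θ * (h : ℝ)) ∧
      |δ h - δ' h| ≤ q ^ m * D₀ * γ ^ (θ * (h : ℝ)) := by
    intro m
    induction m with
    | zero =>
      intro h
      obtain ⟨b1, b2⟩ := hb h
      obtain ⟨b1', b2'⟩ := hb' h
      rw [pow_zero, one_mul]
      constructor
      · calc |ν h - ν' h| ≤ |ν h| + |ν' h| := abs_sub _ _
          _ ≤ D₀ * γ ^ (θ * (h : ℝ)) := by linarith
      · calc |δ h - δ' h| ≤ |δ h| + |δ' h| := abs_sub _ _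
          _ ≤ D₀ * γ ^ (θ * (h : ℝ)) := by linarith
    | succ m ih =>
      intro h
      have hDm : 0 ≤ q ^ m * D₀ := mul_nonneg (pow_nonneg hq0 _) hD0
      have hwh := hw h
      by_cases hh : h ≤ 1
      · -- one flow step at scale `h`
        obtain ⟨l1, l2⟩ := hlip ν δ ν' δ' (q ^ m * D₀) (q ^ m * D₀) hb hb' hDm hDm
          (fun h' => (ih h').1) (fun h' => (ih h').2) h hh
        obtain ⟨r1, r2⟩ := hrec h hh
        obtain ⟨r1', r2'⟩ := hrec' h hh
        obtain ⟨i1, i2⟩ := ih (h - 1)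
        rw [hws1 h] at i1 i2
        have hstep : q ^ m * D₀ * γ ^ (θ * (h : ℝ)) * γ ^ (-θ) +
            c₂ * U * γ ^ (θ * (h : ℝ)) * (q ^ m * D₀ + q ^ m * D₀) =
            q ^ (m + 1) * D₀ * γ ^ (θ * (h : ℝ)) := by
          rw [pow_succ]
          ring
        constructor
        · -- relevant direction: `ν_h - ν'_h = γ⁻¹[(ν_{h-1} - ν'_{h-1}) - (β^h_ν - β'^h_ν)]`
          have e : ν h - ν' h =
              γ⁻¹ * ((ν (h - 1) - ν' (h - 1)) - (βν h ν δ - βν h ν' δ')) := by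
            rw [r1, r1']
            field_simp
            ring
          rw [e, abs_mul, abs_of_pos (inv_pos.2 hγ0)]
          have hγi : γ⁻¹ ≤ 1 := inv_le_one_of_one_le₀ hγ.le
          calc γ⁻¹ * |ν (h - 1) - ν' (h - 1) - (βν h ν δ - βν h ν' δ')|
              ≤ 1 * |ν (h - 1) - ν' (h - 1) - (βν h ν δ - βν h ν' δ')| :=
                mul_le_mul_of_nonneg_right hγi (abs_nonneg _)
            _ ≤ |ν (h - 1) - ν' (h - 1)| + |βν h ν δ - βν h ν' δ'| := by
                rw [one_mul]
                exact abs_sub _ _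
            _ ≤ q ^ m * D₀ * (γ ^ (θ * (h : ℝ)) * γ ^ (-θ)) +
                  c₂ * U * γ ^ (θ * (h : ℝ)) * (q ^ m * D₀ + q ^ m * D₀) := add_le_add i1 l1
            _ = q ^ (m + 1) * D₀ * γ ^ (θ * (h : ℝ)) := by rw [← hstep]; ring
        · -- marginal direction: `δ_h - δ'_h = (δ_{h-1} - δ'_{h-1}) - (β^h_δ - β'^h_δ)`
          have e : δ h - δ' h = (δ (h - 1) - δ' (h - 1)) - (βδ h ν δ - βδ h ν' δ') := by
            rw [r2, r2']
            ring
          rw [e]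
          calc |δ (h - 1) - δ' (h - 1) - (βδ h ν δ - βδ h ν' δ')|
              ≤ |δ (h - 1) - δ' (h - 1)| + |βδ h ν δ - βδ h ν' δ'| := abs_sub _ _
            _ ≤ q ^ m * D₀ * (γ ^ (θ * (h : ℝ)) * γ ^ (-θ)) +
                  c₂ * U * γ ^ (θ * (h : ℝ)) * (q ^ m * D₀ + q ^ m * D₀) := add_le_add i2 l2
            _ = q ^ (m + 1) * D₀ * γ ^ (θ * (h : ℝ)) := by rw [← hstep]; ring
      · -- above scale `1` the two pairs agree
        obtain ⟨a1, a2⟩ := hagree h (by omega)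
        have hnn : 0 ≤ q ^ (m + 1) * D₀ * γ ^ (θ * (h : ℝ)) :=
          mul_nonneg (mul_nonneg (pow_nonneg hq0 _) hD0) hwh.le
        rw [a1, a2, sub_self, sub_self, abs_zero]
        exact ⟨hnn, hnn⟩
  -- `q^m D₀ → 0`
  intro h
  have ht : Tendsto (fun m : ℕ => q ^ m * D₀ * γ ^ (θ * (h : ℝ))) atTop (𝓝 0) := by
    have := ((tendsto_pow_atTop_nhds_zero_of_lt_one hq0 hq1).mul_const D₀).mul_const
      (γ ^ (θ * (h : ℝ)))
    simpa using this
  have e1 : |ν h - ν' h| ≤ 0 := ge_of_tendsto' ht fun m => (claim m h).1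
  have e2 : |δ h - δ' h| ≤ 0 := ge_of_tendsto' ht fun m => (claim m h).2
  exact ⟨sub_eq_zero.1 (abs_nonpos_iff.1 e1), sub_eq_zero.1 (abs_nonpos_iff.1 e2)⟩

/-- `Mas05.L2` · **Lemma 2 as typed in `Mastropietro2005.lean` (`Lemma2Statement`) HOLDS for every pair of
counterterm Beta functionals with the printed size and weighted-Lipschitz bounds** (explicit constants: radius
`c ≥ c₁/(1-γ^{-ϑ})`, coupling `4c₂U ≤ 1-γ^{-ϑ}`).  The printed Lemma 2 is this at the 1D Hubbard functionals,
whose two bounds (`\Eq(aa2)`, `\Eq(aaa1)`, `\Eq(5.8e)`) are the model-specific input not formalised (GAP G-t8-1).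
[cite: Mastropietro2005, §4.4 Lemma 2 (p0011:L151-154), proof (p0012:L22-59)] -/
theorem lemma2Statement_of_lipschitz (βν βδ : ℤ → (ℤ → ℝ) → (ℤ → ℝ) → ℝ) {c c₁ c₂ U γ θ : ℝ}
    (hγ : 1 < γ) (hθ : 0 < θ) (hU : 0 ≤ U) (hc₁ : 0 ≤ c₁)
    (hc : c₁ ≤ c * (1 - γ ^ (-θ))) (hsmall : 4 * c₂ * U ≤ 1 - γ ^ (-θ))
    (hsize : ∀ ν δ : ℤ → ℝ,
      (∀ h : ℤ, |ν h| ≤ c * U * γ ^ (θ * (h : ℝ)) ∧ |δ h| ≤ c * U * γ ^ (θ * (h : ℝ))) →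
        ∀ k : ℤ, k ≤ 1 →
          |βν k ν δ| ≤ c₁ * U * γ ^ (θ * (k : ℝ)) ∧ |βδ k ν δ| ≤ c₁ * U * γ ^ (θ * (k : ℝ)))
    (hlip : ∀ ν δ ν' δ' : ℤ → ℝ, ∀ D₁ D₂ : ℝ,
      (∀ h : ℤ, |ν h| ≤ c * U * γ ^ (θ * (h : ℝ)) ∧ |δ h| ≤ c * U * γ ^ (θ * (h : ℝ))) →
      (∀ h : ℤ, |ν' h| ≤ c * U * γ ^ (θ * (h : ℝ)) ∧ |δ' h| ≤ c * U * γ ^ (θ * (h : ℝ))) →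
      0 ≤ D₁ → 0 ≤ D₂ →
      (∀ h : ℤ, |ν h - ν' h| ≤ D₁ * γ ^ (θ * (h : ℝ))) →
      (∀ h : ℤ, |δ h - δ' h| ≤ D₂ * γ ^ (θ * (h : ℝ))) →
        ∀ k : ℤ, k ≤ 1 →
          |βν k ν δ - βν k ν' δ'| ≤ c₂ * U * γ ^ (θ * (k : ℝ)) * (D₁ + D₂) ∧
          |βδ k ν δ - βδ k ν' δ'| ≤ c₂ * U * γ ^ (θ * (k : ℝ)) * (D₁ + D₂)) :
    Lemma2Statement βν βδ c U γ θ := by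
  obtain ⟨ν, δ, hb, -, hrec⟩ :=
    counterterm_fixedPoint_exists βν βδ hγ hθ hU hc₁ hc hsmall hsize hlip
  exact ⟨ν, δ, fun h _ => hb h, hrec⟩

/-- `Mas05.L2` · **"If `U` is sufficiently small"** (p0012:L40): for fixed `γ > 1`, `ϑ > 0` and constants
`c₁ ≤ c(1-γ^{-ϑ})`, `c₂ ≥ 0` there is `ε > 0` (namely `(1-γ^{-ϑ})/(4(c₂+1))`) such that for every coupling
`0 ≤ U ≤ ε`, counterterm Beta functionals with the size and Lipschitz bounds at that `U` admit the sequences of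
Lemma 2. [cite: Mastropietro2005, §4.4 Lemma 2 (p0011:L151-154), proof (p0012:L40-59)] -/
theorem lemma2Statement_of_small_coupling (βν βδ : ℤ → (ℤ → ℝ) → (ℤ → ℝ) → ℝ) {c c₁ c₂ γ θ : ℝ}
    (hγ : 1 < γ) (hθ : 0 < θ) (hc₁ : 0 ≤ c₁) (hc₂ : 0 ≤ c₂) (hc : c₁ ≤ c * (1 - γ ^ (-θ))) :
    ∃ ε : ℝ, 0 < ε ∧ ∀ U : ℝ, 0 ≤ U → U ≤ ε →
      (∀ ν δ : ℤ → ℝ,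
        (∀ h : ℤ, |ν h| ≤ c * U * γ ^ (θ * (h : ℝ)) ∧ |δ h| ≤ c * U * γ ^ (θ * (h : ℝ))) →
          ∀ k : ℤ, k ≤ 1 →
            |βν k ν δ| ≤ c₁ * U * γ ^ (θ * (k : ℝ)) ∧ |βδ k ν δ| ≤ c₁ * U * γ ^ (θ * (k : ℝ))) →
      (∀ ν δ ν' δ' : ℤ → ℝ, ∀ D₁ D₂ : ℝ,
        (∀ h : ℤ, |ν h| ≤ c * U * γ ^ (θ * (h : ℝ)) ∧ |δ h| ≤ c * U * γ ^ (θ * (h : ℝ))) →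
        (∀ h : ℤ, |ν' h| ≤ c * U * γ ^ (θ * (h : ℝ)) ∧ |δ' h| ≤ c * U * γ ^ (θ * (h : ℝ))) →
        0 ≤ D₁ → 0 ≤ D₂ →
        (∀ h : ℤ, |ν h - ν' h| ≤ D₁ * γ ^ (θ * (h : ℝ))) →
        (∀ h : ℤ, |δ h - δ' h| ≤ D₂ * γ ^ (θ * (h : ℝ))) →
          ∀ k : ℤ, k ≤ 1 →
            |βν k ν δ - βν k ν' δ'| ≤ c₂ * U * γ ^ (θ * (k : ℝ)) * (D₁ + D₂) ∧
            |βδ k ν δ - βδ k ν' δ'| ≤ c₂ * U * γ ^ (θ * (k : ℝ)) * (D₁ + D₂)) →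
      Lemma2Statement βν βδ c U γ θ := by
  have hr1 : γ ^ (-θ) < 1 := Real.rpow_lt_one_of_one_lt_of_neg hγ (by linarith)
  have h1r : 0 < 1 - γ ^ (-θ) := by linarith
  refine ⟨(1 - γ ^ (-θ)) / (4 * (c₂ + 1)), div_pos h1r (by positivity), fun U hU0 hUε hsize hlip => ?_⟩
  have hsmall : 4 * c₂ * U ≤ 1 - γ ^ (-θ) := by
    have h4 : 0 < 4 * (c₂ + 1) := by positivity
    have hU' : 4 * (c₂ + 1) * U ≤ 1 - γ ^ (-θ) := by
      rw [le_div_iff₀ h4] at hUε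
      linarith
    calc 4 * c₂ * U ≤ 4 * (c₂ + 1) * U := by linarith
      _ ≤ 1 - γ ^ (-θ) := hU'
  exact lemma2Statement_of_lipschitz βν βδ hγ hθ hU0 hc₁ hc hsmall hsize hlip

end Mastropietro2005

end Literature.MathematicalPhysics.QuantumLattice.FermiRG
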